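import Summits.ValiantsHypothesis.ValiantsHypothesis.Theses.FreeFermionCLL

/-!
# Route FreeFermionCLL — item `Assembly` (stmt-ValiantsHypothesis-13564)

`Assembly := PMCorrelationGap → GapRefutesQP → TotalRankLeDc → QpArith → DcqpToVH → ValiantsHypothesis`.

Pure logic over the route's items, literally the shape of the route's (sorry-free) deciding theorem
`Summit.ValiantsHypothesis.ValiantsHypothesis.Theses.FreeFermionCLL.closes`: `GapRefutesQP` turns the
target `PMCorrelationGap` (the correlation gap of quasi-polynomial-total-rank principal-minor forms
with `per_n`), the normal form `TotalRankLeDc` (a principal-minor representation of `per_n(x + J)` of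
total rank `≤ n² · dc(per_n)`) and the arithmetic glue `QpArith` into "`dc(per_n)` is not
quasi-polynomially bounded" — the bodies of `TotalRankLeDc` and `QpArith` are inlined verbatim in
`GapRefutesQP`, so the applications are definitional — and `DcqpToVH` turns that into
`ValiantsHypothesis` (`VP_ℂ ≠ VNP_ℂ`).

No new definitions; no named facts; unconditional.
-/

-- `Summit.ValiantsHypothesis.ValiantsHypothesis.…` is the tree's mandated single-conjunct layout (Sub = Summit).
set_option linter.dupNamespace false

namespace Summit.ValiantsHypothesis.ValiantsHypothesis.Theorems.FreeFermionCLL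

/-- **`Assembly` holds** (item stmt-ValiantsHypothesis-13564, assembly of route FreeFermionCLL):
`PMCorrelationGap → GapRefutesQP → TotalRankLeDc → QpArith → DcqpToVH → ValiantsHypothesis`.
Pure logic: feed the target, the normal form and the arithmetic glue to `GapRefutesQP` to get
`¬ IsQPBounded (fun n => dc(per_n))`, then apply `DcqpToVH`. [folklore] -/
theorem assembly_proof :
    Summit.ValiantsHypothesis.ValiantsHypothesis.Theses.FreeFermionCLL.Assembly := by
  unfold Summit.ValiantsHypothesis.ValiantsHypothesis.Theses.FreeFermionCLL.Assembly
  intro hX hG hT hQ hV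
  exact hV (hG hX hT hQ)

end Summit.ValiantsHypothesis.ValiantsHypothesis.Theorems.FreeFermionCLL
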